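import Summits.QuantumFields.BalabanUV.Beta.GAN24.CombChartQuarticContactChargeZero
import Summits.QuantumFields.BalabanUV.Beta.GAN24.CombChargeParityOddOfQuarticLaw

/-!
# `BalabanUV.Beta.GAN24.CombChartParityOddOfQuarticLaw` — binder row G-an2-4 ∕ (CONV-C), TRANSFER-III, row (C) at levels ≥ 1, THE PARITY ROUTE AT THE (III′) COMB CHART ASSEMBLED MODULO ONE
# LETTER: **GIVEN an2's QUARTIC REFLECTION LAW OF THE COMB-CHART MEMBER `T̃′_j` AT LEVEL `j` (the conclusion shape of `SpineRecursiveT2AllComb.T2RecOf_bref_all_of_letters_comb` at `j`,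
# contact in an1's LEGGED letters `bhKStepSh 3 Lc (Dsh Lc) j`, `ctGenM 3 (bhK Lc + Dsh Lc)`, a second symbol `h α`, a row-parity-odd local remainder `R2 α` — WANTED W-an2-1′ at the record),
# THE MEMBER's ff CHARGE IS LEG-ANTISYMMETRIC ON EVERY PATTERN WITH AN ODD AXIS — SO ITS LEG-SYMMETRISED (C) ROW VANISHES THERE WITHOUT ANY VALUATION**, for ANY sym record `tabs` with
# (V-r)(V-ff0)(H-r) displayed and at an1's record (the (III′) twin of road-P2 g48's `CombChargeParityOddOfQuarticLaw` §2–§3; OWNER `b2b-balaban-gan24-p1`, gen 51, memo M3′)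

NOT IN PRINT; OUR BOOKKEEPING ([folklore] composition BY NAME: road-P2 g48's GENERIC §1 (`zmode_add_legSwap_eq_zero_of_refl_add`, `legAntisym_of_split`) and §3 (`zmode_unitS₂_inl_inl`) of
`CombChargeParityOddOfQuarticLaw`; MY (M2′) `CombChartQuarticContactChargeZero.zmode_conjW_combChart_eq_zero`; an2's slot letters `SpineRooted.T2RecOf_loc ∕ T2RecOf_translate` at the
comb chart (`CombChartStepJets.decays_GcombSh ∕ shiftK_GcombSh ∕ locStencil_SpureCombOf ∕ SpureCombOf_translate`, the record's `hM hB hmix hMt hBt hmixt`), `SymShiftedSpread.spr_bhKStepSh`,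
an1's `DshAn1Spread.spr_Dsh`, `SymSecondOrderSplitLoc.locStencil_diagK_mul_ctGenM`, `SecondOrderBorderClassKit.locStencil₂_conjW`; 0 `def`, 0 cited facts, 0 `def … : Prop`, 0 sorry; no
existing file touched).
HONEST FRAMING (cell contract, verbatim): «discharging `BetaPertH` makes Bałaban's UV stability UNCONDITIONAL — a real constructive-QFT result; it is NOT the continuum limit and NOT the
Clay problem.»  HONEST DEPENDENCY (verbatim): «continuum YM on T⁴ ⇐ BetaPertH ∧ nine spine estimates (0/9 proved); BetaPertH ⇐ (D1) ∧ (D4) ∧ CAP+tail; G-an2-4 gates asym, D1 and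
NE2/3/4.»
WHAT: **`zmode_T2RecOf_combChart_add_legSwap_eq_zero_of_law`** (table), `zmode_unitS₂_T2RecOf_combChart_add_legSwap_eq_zero_of_law` (the member `unitS₂ sf sm T̃′_j` in any units),
`zmode_unitS₂_T2RecOf_combChart_an1_add_legSwap_eq_zero_of_law` (an1's record `symTablesAn1S2 3 Lc cΛt`: first-order letters DISCHARGED, law still DISPLAYED).
WHAT THIS IS NOT: the law `hlaw` is a HYPOTHESIS (W-an2-1′: the record's quartic TABLE law at every level — `SpineRecursiveT2AllComb` proves it from table letters an2 has not all
discharged at `symTablesAn1S2`); this is the ODD-class half only (the even classes are MY (K) `CombChartChargeEvenClassRow` ⟸ `hB0 ∧ hX`); asserts NO value; NEVER «G-an2-4 closed» as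
(CONV-C); NOT D1, NOT `BetaPertH`, NOT continuum, NOT Clay; not in print.  2026-08-27.
-/

noncomputable section

open Finset
open scoped BigOperators
open Literature.MathematicalPhysics.QuantumFieldTheory
open Literature.MathematicalPhysics.QuantumFieldTheory.Balaban1983to89
open Literature.MathematicalPhysics.QuantumFieldTheory.Balaban1983to89.Beta
open ExpKernelCalculus (MKer shiftK BiLoc Decays)
open OneStepResolventKernel (Fib LocStencil)
open BalabanStepJets (locStencil_mono)
open OneStepResolventKernel (decays_mono)
open AffineAveraging (box toSite)
open AveragingContoursRooted (ctr ctrOff ctrOff_mem_box)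
open BalabanCompositeJets (LocStencil₂ LocStencil₂.mono)
open BalabanStepW2 (locStencil₂_add')
open PolarizationSign (reflSign)
open KernelReflection (refK)
open ResolventReflection (bref Φ)
open Summit.QuantumFields.BalabanUV.Beta.TameKernelCalculus (Spr trK)
open Summit.QuantumFields.BalabanUV.Beta.ChartConjugation (conjV conjW)
open Summit.QuantumFields.BalabanUV.Beta.BorderedHessian (diagK sgnK bhK stepScale)
open Summit.QuantumFields.BalabanUV.Beta.SecondOrderUnits (unitS₂)
open Summit.QuantumFields.BalabanUV.Beta.SymmetrisedStepJets (SymTables)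
open Summit.QuantumFields.BalabanUV.Beta.SymShiftedSpread (bhKStepSh bhKStepSh_zero spr_bhKStepSh)
open Summit.QuantumFields.BalabanUV.Beta.E3ContactGenerator (ctGenM)
open Summit.QuantumFields.BalabanUV.Beta.DshAn1 (Dsh spr_Dsh)
open Summit.QuantumFields.BalabanUV.Beta.SymAveragingHessianCounts (symVhSAt symHessFFAt symVhSAt_hV0_ctr)
open Summit.QuantumFields.BalabanUV.Beta.SpineRooted (T2RecOf T2RecOf_loc T2RecOf_translate)
open Summit.QuantumFields.BalabanUV.Beta.CombChartStepJets (GcombSh decays_GcombSh shiftK_GcombSh SpureCombOf locStencil_SpureCombOf SpureCombOf_translate)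
open Summit.QuantumFields.BalabanUV.Beta.SymVhSliceReflectionAn1 (hVfm_sym hVmf_sym hVmm_sym hHr_sym')
open Summit.QuantumFields.BalabanUV.Beta.SymSecondOrderTablesAn1 (symTablesAn1S2)
open Summit.QuantumFields.BalabanUV.Beta.SecondOrderBorderClassKit (locStencil₂_conjW)
open Summit.QuantumFields.BalabanUV.Beta.SymSecondOrderSplitLoc (locStencil_diagK_mul_ctGenM)
open Summit.QuantumFields.BalabanUV.Beta.GAN24.BiStencilZeroMode (Tab zmode)
open Summit.QuantumFields.BalabanUV.Beta.GAN24.CombChargeParityOddOfQuarticLaw (zmode_add_legSwap_eq_zero_of_refl_add legAntisym_of_split zmode_unitS₂_inl_inl)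
open Summit.QuantumFields.BalabanUV.Beta.GAN24.CombChartQuarticContactChargeZero (zmode_conjW_combChart_eq_zero)

namespace Summit.QuantumFields.BalabanUV.Beta.GAN24.CombChartParityOddOfQuarticLaw

variable {Lc : ℕ} [NeZero Lc]

/-- NOT IN PRINT; OUR BOOKKEEPING.  **THE COMB-CHART TABLE `T̃′_j`'s ff CHARGE IS LEG-ANTISYMMETRIC ON EVERY PATTERN WITH AN ODD AXIS — GIVEN THE QUARTIC TABLE LAW AT LEVEL `j`**
(any `tabs : SymTables 3 Lc` with (V-r)(V-ff0)(H-r); pin `(cE, cVH) = (Lc⁴, −Lc⁸∕2)`, any `cΛ cE₂ cB`, any quartic table `Tc`; the law `hlaw` in an2's comb letters with generator scalar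
`γ`, second symbols `h α` (local bi-stencil families with finitely supported field legs) and row-parity-odd local remainders `R2 α`). -/
theorem zmode_T2RecOf_combChart_add_legSwap_eq_zero_of_law (hLc : Odd Lc) (tabs : SymTables 3 Lc) (cΛ cE₂ cB : ℝ) (Tc : Fin 4 → Fin 4 → Fin 4 → Fin 4 → ℝ)
    (hVfm : ∀ (α κ' : Fin 4) (u x z : Fin 4 → ℤ) (β μ : Fin 4), tabs.V κ' (bref α κ' u) x z (Sum.inl β) (Sum.inr μ) =
      (reflSign α κ' • refK (Φ (d := 3) Lc α) (tabs.V κ' u + conjV (bhK (d := 3) Lc + Dsh Lc)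
        ((((Lc : ℝ) ^ 4)⁻¹) • diagK (ctGenM 3 (bhK Lc + Dsh Lc) α Lc κ' u)))) x z (Sum.inl β) (Sum.inr μ))
    (hVmf : ∀ (α κ' : Fin 4) (u x z : Fin 4 → ℤ) (μ β : Fin 4), tabs.V κ' (bref α κ' u) x z (Sum.inr μ) (Sum.inl β) =
      (reflSign α κ' • refK (Φ (d := 3) Lc α) (tabs.V κ' u + conjV (bhK (d := 3) Lc + Dsh Lc)
        ((((Lc : ℝ) ^ 4)⁻¹) • diagK (ctGenM 3 (bhK Lc + Dsh Lc) α Lc κ' u)))) x z (Sum.inr μ) (Sum.inl β))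
    (hVmm : ∀ (α κ' : Fin 4) (u x z : Fin 4 → ℤ) (μ μ' : Fin 4), tabs.V κ' (bref α κ' u) x z (Sum.inr μ) (Sum.inr μ') =
      (reflSign α κ' • refK (Φ (d := 3) Lc α) (tabs.V κ' u + conjV (bhK (d := 3) Lc + Dsh Lc)
        ((((Lc : ℝ) ^ 4)⁻¹) • diagK (ctGenM 3 (bhK Lc + Dsh Lc) α Lc κ' u)))) x z (Sum.inr μ) (Sum.inr μ'))
    (hV0 : ∀ (κ : Fin 4) (w x z : Fin 4 → ℤ) (β β' : Fin 4), tabs.V κ w x z (Sum.inl β) (Sum.inl β') = 0)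
    (hHr : ∀ (α' μ : Fin 4) (y : Fin 4 → ℤ), tabs.H μ (bref α' μ y) = reflSign α' μ • refK (Φ (d := 3) Lc α') (tabs.H μ y))
    (j : ℕ) (γ : ℝ)
    (h : Fin 4 → Fin 4 → (Fin 4 → ℤ) → Fin 4 → (Fin 4 → ℤ) → (Fin 4 → ℤ) → Fib 3 → ℝ)
    (hhL : ∀ α : Fin 4, ∃ C δ : ℝ, 0 < δ ∧ LocStencil₂ (fun κ u κ' u' => diagK (h α κ u κ' u')) C δ)
    (hh : ∀ (α κ : Fin 4) (u : Fin 4 → ℤ) (κ' : Fin 4) (u' : Fin 4 → ℤ), ∃ s : Finset (Fin 4 → ℤ), ∀ x ∉ s, ∀ (β : Fin 4), h α κ u κ' u' x (Sum.inl β) = 0)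
    (R2 : Fin 4 → Fin 4 → (Fin 4 → ℤ) → Fin 4 → (Fin 4 → ℤ) → MKer 4 (Fib 3))
    (hR2c : ∀ α : Fin 4, ∃ C δ : ℝ, 0 < δ ∧ LocStencil₂ (R2 α) C δ)
    (hR2p : ∀ (α : Fin 4) κ u κ' u', trK (R2 α κ u κ' u') = -sgnK (R2 α κ u κ' u'))
    (hlaw : ∀ (α κ : Fin 4) (u : Fin 4 → ℤ) (κ' : Fin 4) (u' : Fin 4 → ℤ),
      T2RecOf 3 Lc (GcombSh Lc) (SpureCombOf tabs ((Lc : ℝ) ^ 4) (-((Lc : ℝ) ^ 8 / 2)) cΛ) tabs.M cE₂ cB Tc tabs.vh₂S tabs.mixFF j κ (bref α κ u) κ' (bref α κ' u') =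
        (reflSign α κ * reflSign α κ') • refK (Φ Lc α)
          (T2RecOf 3 Lc (GcombSh Lc) (SpureCombOf tabs ((Lc : ℝ) ^ 4) (-((Lc : ℝ) ^ 8 / 2)) cΛ) tabs.M cE₂ cB Tc tabs.vh₂S tabs.mixFF j κ u κ' u' +
            conjW (bhKStepSh 3 Lc (Dsh Lc) j)
              (SpureCombOf tabs ((Lc : ℝ) ^ 4) (-((Lc : ℝ) ^ 8 / 2)) cΛ j κ u)
              (SpureCombOf tabs ((Lc : ℝ) ^ 4) (-((Lc : ℝ) ^ 8 / 2)) cΛ j κ' u')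
              (diagK fun p a => γ * ctGenM 3 (bhK Lc + Dsh Lc) α Lc κ u p a) (diagK fun p a => γ * ctGenM 3 (bhK Lc + Dsh Lc) α Lc κ' u' p a)
              (diagK (h α κ u κ' u')) +
            R2 α κ u κ' u'))
    {κ κ' κ₁ κ₂ : Fin 4} (hodd : ∃ α : Fin 4, reflSign α κ * reflSign α κ' * reflSign α κ₁ * reflSign α κ₂ = -1) :
    zmode Lc (T2RecOf 3 Lc (GcombSh Lc) (SpureCombOf tabs ((Lc : ℝ) ^ 4) (-((Lc : ℝ) ^ 8 / 2)) cΛ) tabs.M cE₂ cB Tc tabs.vh₂S tabs.mixFF j) κ κ' (Sum.inl κ₁) (Sum.inl κ₂)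
      + zmode Lc (T2RecOf 3 Lc (GcombSh Lc) (SpureCombOf tabs ((Lc : ℝ) ^ 4) (-((Lc : ℝ) ^ 8 / 2)) cΛ) tabs.M cE₂ cB Tc tabs.vh₂S tabs.mixFF j) κ κ' (Sum.inl κ₂) (Sum.inl κ₁)
        = 0 := by
  classical
  obtain ⟨α, hα⟩ := hodd
  have hL1 : 1 ≤ Lc := hLc.pos
  -- classes of the member, the contact defect and the remainder at ONE common rate
  obtain ⟨CT, δT, hδT, hTc⟩ := T2RecOf_loc cE₂ cB Tc tabs.vh₂S tabs.mixFF hL1 (decays_GcombSh (d := 3) Lc)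
    (locStencil_SpureCombOf tabs ((Lc : ℝ) ^ 4) (-((Lc : ℝ) ^ 8 / 2)) cΛ) tabs.hM tabs.hB tabs.hmix j
  obtain ⟨Cs, δs, hδs, hS⟩ := locStencil_SpureCombOf tabs ((Lc : ℝ) ^ 4) (-((Lc : ℝ) ^ 8 / 2)) cΛ j
  obtain ⟨C𝕄, δ𝕄, hδ𝕄, h𝕄⟩ := spr_bhKStepSh (d := 3) (Lc := Lc) (spr_Dsh hL1) j
  have hBsp : Spr (bhK (d := 3) Lc + Dsh Lc) := by
    simpa only [bhKStepSh_zero] using spr_bhKStepSh (d := 3) (Lc := Lc) (spr_Dsh hL1) 0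
  obtain ⟨CB, δB, hδB, hB⟩ := hBsp
  obtain ⟨CR, δR, hδR, hRc⟩ := hR2c α
  obtain ⟨C2, δh, hδh, hX₂0⟩ := hhL α
  set δ : ℝ := min (min (min δT δs) (min δ𝕄 δR)) (min (δB / 2) δh) with hδdef
  have hδ : 0 < δ := lt_min (lt_min (lt_min hδT hδs) (lt_min hδ𝕄 hδR)) (lt_min (by linarith) hδh)
  have hδ1 : δ ≤ min (min δT δs) (min δ𝕄 δR) := min_le_left _ _
  have hδT' : δ ≤ δT := hδ1.trans ((min_le_left _ _).trans (min_le_left _ _))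
  have hδs' : δ ≤ δs := hδ1.trans ((min_le_left _ _).trans (min_le_right _ _))
  have hδ𝕄' : δ ≤ δ𝕄 := hδ1.trans ((min_le_right _ _).trans (min_le_left _ _))
  have hδR' : δ ≤ δR := hδ1.trans ((min_le_right _ _).trans (min_le_right _ _))
  have hδB' : 2 * δ ≤ δB := by have := (min_le_right (min (min δT δs) (min δ𝕄 δR)) (min (δB / 2) δh)).trans (min_le_left _ _); linarith
  have hδh' : δ ≤ δh := (min_le_right _ _).trans (min_le_right _ _)
  have hCs : 0 ≤ Cs := (hS 0 0).nonneg (Sum.inl 0)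
  have hC𝕄 : 0 ≤ C𝕄 := h𝕄.nonneg (Sum.inl 0)
  have hCB : 0 ≤ CB := hB.nonneg (Sum.inl 0)
  have hTc' := hTc.mono hδT'
  have hRc' := hRc.mono hδR'
  have hS' : LocStencil (SpureCombOf tabs ((Lc : ℝ) ^ 4) (-((Lc : ℝ) ^ 8 / 2)) cΛ j) Cs δ := locStencil_mono hS hCs hδs'
  have h𝕄' : Decays (bhKStepSh 3 Lc (Dsh Lc) j) C𝕄 δ := decays_mono h𝕄 hC𝕄 le_rfl hδ𝕄'
  have hB2 : Decays (bhK (d := 3) Lc + Dsh Lc) CB (2 * δ) := decays_mono hB hCB le_rfl hδB'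
  have hX := locStencil_diagK_mul_ctGenM (d := 3) hB2 (by linarith) γ α Lc
  have e2 : 2 * δ / 2 = δ := by ring
  rw [e2] at hX
  have hX₂ : LocStencil₂ (fun κ u κ' u' => diagK (h α κ u κ' u')) C2 δ := hX₂0.mono hδh'
  obtain ⟨CW, hWc⟩ := locStencil₂_conjW h𝕄' hS' hX hX₂ hδ
  -- common rate δ/8 for everybody
  have h8 : δ / 8 ≤ δ := by linarith
  have hδ8 : 0 < δ / 8 := by positivity
  have hTc8 := hTc'.mono h8
  have hRc8 := hRc'.mono h8
  -- the defect's leg-antisymmetric charge: contact part zero (both leg orders, M2′), remainder parity-odd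
  have hJ := legAntisym_of_split (N := Lc) hWc hRc8 hδ8 (hR2p α)
    (zmode_conjW_combChart_eq_zero hLc tabs cΛ γ hVfm hVmf hVmm hV0 hHr j α (h α) (hhL α) (hh α) κ κ' κ₁ κ₂)
    (zmode_conjW_combChart_eq_zero hLc tabs cΛ γ hVfm hVmf hVmm hV0 hHr j α (h α) (hhL α) (hh α) κ κ' κ₂ κ₁)
  have hJc := locStencil₂_add' hWc hRc8
  exact zmode_add_legSwap_eq_zero_of_refl_add (N := Lc) α
    (T2RecOf_translate (G := GcombSh Lc) (S := SpureCombOf tabs ((Lc : ℝ) ^ 4) (-((Lc : ℝ) ^ 8 / 2)) cΛ) (M := tabs.M) (cE₂ := cE₂) (cB := cB) (T := Tc)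
      (vh₂S := tabs.vh₂S) (mixFF := tabs.mixFF) (shiftK_GcombSh (d := 3) Lc) (SpureCombOf_translate tabs _ _ cΛ) tabs.hMt tabs.hBt tabs.hmixt j)
    (fun κ u κ' u' => by rw [hlaw α κ u κ' u', add_assoc]) hTc8 hJc hδ8 hJ hα

/-- NOT IN PRINT; OUR BOOKKEEPING.  **THE SAME FOR THE MEMBER IN ANY UNITS** `unitS₂ sf sm T̃′_j` (the (III′) tower's member has `sf = sfStep Lc j`, `sm = smStep 3 Lc j`): on the ff block the
change of units is a scalar (road-P2's `zmode_unitS₂_inl_inl`). -/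
theorem zmode_unitS₂_T2RecOf_combChart_add_legSwap_eq_zero_of_law (hLc : Odd Lc) (tabs : SymTables 3 Lc) (cΛ cE₂ cB : ℝ) (Tc : Fin 4 → Fin 4 → Fin 4 → Fin 4 → ℝ)
    (hVfm : ∀ (α κ' : Fin 4) (u x z : Fin 4 → ℤ) (β μ : Fin 4), tabs.V κ' (bref α κ' u) x z (Sum.inl β) (Sum.inr μ) =
      (reflSign α κ' • refK (Φ (d := 3) Lc α) (tabs.V κ' u + conjV (bhK (d := 3) Lc + Dsh Lc)
        ((((Lc : ℝ) ^ 4)⁻¹) • diagK (ctGenM 3 (bhK Lc + Dsh Lc) α Lc κ' u)))) x z (Sum.inl β) (Sum.inr μ))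
    (hVmf : ∀ (α κ' : Fin 4) (u x z : Fin 4 → ℤ) (μ β : Fin 4), tabs.V κ' (bref α κ' u) x z (Sum.inr μ) (Sum.inl β) =
      (reflSign α κ' • refK (Φ (d := 3) Lc α) (tabs.V κ' u + conjV (bhK (d := 3) Lc + Dsh Lc)
        ((((Lc : ℝ) ^ 4)⁻¹) • diagK (ctGenM 3 (bhK Lc + Dsh Lc) α Lc κ' u)))) x z (Sum.inr μ) (Sum.inl β))
    (hVmm : ∀ (α κ' : Fin 4) (u x z : Fin 4 → ℤ) (μ μ' : Fin 4), tabs.V κ' (bref α κ' u) x z (Sum.inr μ) (Sum.inr μ') =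
      (reflSign α κ' • refK (Φ (d := 3) Lc α) (tabs.V κ' u + conjV (bhK (d := 3) Lc + Dsh Lc)
        ((((Lc : ℝ) ^ 4)⁻¹) • diagK (ctGenM 3 (bhK Lc + Dsh Lc) α Lc κ' u)))) x z (Sum.inr μ) (Sum.inr μ'))
    (hV0 : ∀ (κ : Fin 4) (w x z : Fin 4 → ℤ) (β β' : Fin 4), tabs.V κ w x z (Sum.inl β) (Sum.inl β') = 0)
    (hHr : ∀ (α' μ : Fin 4) (y : Fin 4 → ℤ), tabs.H μ (bref α' μ y) = reflSign α' μ • refK (Φ (d := 3) Lc α') (tabs.H μ y))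
    (j : ℕ) (γ : ℝ)
    (h : Fin 4 → Fin 4 → (Fin 4 → ℤ) → Fin 4 → (Fin 4 → ℤ) → (Fin 4 → ℤ) → Fib 3 → ℝ)
    (hhL : ∀ α : Fin 4, ∃ C δ : ℝ, 0 < δ ∧ LocStencil₂ (fun κ u κ' u' => diagK (h α κ u κ' u')) C δ)
    (hh : ∀ (α κ : Fin 4) (u : Fin 4 → ℤ) (κ' : Fin 4) (u' : Fin 4 → ℤ), ∃ s : Finset (Fin 4 → ℤ), ∀ x ∉ s, ∀ (β : Fin 4), h α κ u κ' u' x (Sum.inl β) = 0)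
    (R2 : Fin 4 → Fin 4 → (Fin 4 → ℤ) → Fin 4 → (Fin 4 → ℤ) → MKer 4 (Fib 3))
    (hR2c : ∀ α : Fin 4, ∃ C δ : ℝ, 0 < δ ∧ LocStencil₂ (R2 α) C δ)
    (hR2p : ∀ (α : Fin 4) κ u κ' u', trK (R2 α κ u κ' u') = -sgnK (R2 α κ u κ' u'))
    (hlaw : ∀ (α κ : Fin 4) (u : Fin 4 → ℤ) (κ' : Fin 4) (u' : Fin 4 → ℤ),
      T2RecOf 3 Lc (GcombSh Lc) (SpureCombOf tabs ((Lc : ℝ) ^ 4) (-((Lc : ℝ) ^ 8 / 2)) cΛ) tabs.M cE₂ cB Tc tabs.vh₂S tabs.mixFF j κ (bref α κ u) κ' (bref α κ' u') =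
        (reflSign α κ * reflSign α κ') • refK (Φ Lc α)
          (T2RecOf 3 Lc (GcombSh Lc) (SpureCombOf tabs ((Lc : ℝ) ^ 4) (-((Lc : ℝ) ^ 8 / 2)) cΛ) tabs.M cE₂ cB Tc tabs.vh₂S tabs.mixFF j κ u κ' u' +
            conjW (bhKStepSh 3 Lc (Dsh Lc) j)
              (SpureCombOf tabs ((Lc : ℝ) ^ 4) (-((Lc : ℝ) ^ 8 / 2)) cΛ j κ u)
              (SpureCombOf tabs ((Lc : ℝ) ^ 4) (-((Lc : ℝ) ^ 8 / 2)) cΛ j κ' u')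
              (diagK fun p a => γ * ctGenM 3 (bhK Lc + Dsh Lc) α Lc κ u p a) (diagK fun p a => γ * ctGenM 3 (bhK Lc + Dsh Lc) α Lc κ' u' p a)
              (diagK (h α κ u κ' u')) +
            R2 α κ u κ' u'))
    (sf sm : ℝ) {κ κ' κ₁ κ₂ : Fin 4} (hodd : ∃ α : Fin 4, reflSign α κ * reflSign α κ' * reflSign α κ₁ * reflSign α κ₂ = -1) :
    zmode Lc (unitS₂ sf sm (T2RecOf 3 Lc (GcombSh Lc) (SpureCombOf tabs ((Lc : ℝ) ^ 4) (-((Lc : ℝ) ^ 8 / 2)) cΛ) tabs.M cE₂ cB Tc tabs.vh₂S tabs.mixFF j)) κ κ' (Sum.inl κ₁) (Sum.inl κ₂)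
      + zmode Lc (unitS₂ sf sm (T2RecOf 3 Lc (GcombSh Lc) (SpureCombOf tabs ((Lc : ℝ) ^ 4) (-((Lc : ℝ) ^ 8 / 2)) cΛ) tabs.M cE₂ cB Tc tabs.vh₂S tabs.mixFF j)) κ κ' (Sum.inl κ₂) (Sum.inl κ₁)
        = 0 := by
  rw [zmode_unitS₂_inl_inl, zmode_unitS₂_inl_inl, ← mul_add,
    zmode_T2RecOf_combChart_add_legSwap_eq_zero_of_law hLc tabs cΛ cE₂ cB Tc hVfm hVmf hVmm hV0 hHr j γ h hhL hh R2 hR2c hR2p hlaw hodd, mul_zero]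

/-- NOT IN PRINT; OUR BOOKKEEPING.  **THE SAME AT an1's RECORD `symTablesAn1S2 3 Lc cΛt`** — the five first-order letters DISCHARGED (an1's `SymVhSliceReflectionAn1.hVfm_sym ∕ hVmf_sym ∕
hVmm_sym ∕ hHr_sym'`, `SymAveragingHessianCounts.symVhSAt_hV0_ctr`); the quartic law at level `j` stays DISPLAYED (W-an2-1′). -/
theorem zmode_unitS₂_T2RecOf_combChart_an1_add_legSwap_eq_zero_of_law (hLc : Odd Lc) (cΛt cΛ cE₂ cB : ℝ) (Tc : Fin 4 → Fin 4 → Fin 4 → Fin 4 → ℝ)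
    (j : ℕ) (γ : ℝ)
    (h : Fin 4 → Fin 4 → (Fin 4 → ℤ) → Fin 4 → (Fin 4 → ℤ) → (Fin 4 → ℤ) → Fib 3 → ℝ)
    (hhL : ∀ α : Fin 4, ∃ C δ : ℝ, 0 < δ ∧ LocStencil₂ (fun κ u κ' u' => diagK (h α κ u κ' u')) C δ)
    (hh : ∀ (α κ : Fin 4) (u : Fin 4 → ℤ) (κ' : Fin 4) (u' : Fin 4 → ℤ), ∃ s : Finset (Fin 4 → ℤ), ∀ x ∉ s, ∀ (β : Fin 4), h α κ u κ' u' x (Sum.inl β) = 0)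
    (R2 : Fin 4 → Fin 4 → (Fin 4 → ℤ) → Fin 4 → (Fin 4 → ℤ) → MKer 4 (Fib 3))
    (hR2c : ∀ α : Fin 4, ∃ C δ : ℝ, 0 < δ ∧ LocStencil₂ (R2 α) C δ)
    (hR2p : ∀ (α : Fin 4) κ u κ' u', trK (R2 α κ u κ' u') = -sgnK (R2 α κ u κ' u'))
    (hlaw : ∀ (α κ : Fin 4) (u : Fin 4 → ℤ) (κ' : Fin 4) (u' : Fin 4 → ℤ),
      T2RecOf 3 Lc (GcombSh Lc) (SpureCombOf (symTablesAn1S2 3 Lc cΛt) ((Lc : ℝ) ^ 4) (-((Lc : ℝ) ^ 8 / 2)) cΛ) (symTablesAn1S2 3 Lc cΛt).M cE₂ cB Tc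
          (symTablesAn1S2 3 Lc cΛt).vh₂S (symTablesAn1S2 3 Lc cΛt).mixFF j κ (bref α κ u) κ' (bref α κ' u') =
        (reflSign α κ * reflSign α κ') • refK (Φ Lc α)
          (T2RecOf 3 Lc (GcombSh Lc) (SpureCombOf (symTablesAn1S2 3 Lc cΛt) ((Lc : ℝ) ^ 4) (-((Lc : ℝ) ^ 8 / 2)) cΛ) (symTablesAn1S2 3 Lc cΛt).M cE₂ cB Tc
              (symTablesAn1S2 3 Lc cΛt).vh₂S (symTablesAn1S2 3 Lc cΛt).mixFF j κ u κ' u' +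
            conjW (bhKStepSh 3 Lc (Dsh Lc) j)
              (SpureCombOf (symTablesAn1S2 3 Lc cΛt) ((Lc : ℝ) ^ 4) (-((Lc : ℝ) ^ 8 / 2)) cΛ j κ u)
              (SpureCombOf (symTablesAn1S2 3 Lc cΛt) ((Lc : ℝ) ^ 4) (-((Lc : ℝ) ^ 8 / 2)) cΛ j κ' u')
              (diagK fun p a => γ * ctGenM 3 (bhK Lc + Dsh Lc) α Lc κ u p a) (diagK fun p a => γ * ctGenM 3 (bhK Lc + Dsh Lc) α Lc κ' u' p a)
              (diagK (h α κ u κ' u')) +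
            R2 α κ u κ' u'))
    (sf sm : ℝ) {κ κ' κ₁ κ₂ : Fin 4} (hodd : ∃ α : Fin 4, reflSign α κ * reflSign α κ' * reflSign α κ₁ * reflSign α κ₂ = -1) :
    zmode Lc (unitS₂ sf sm (T2RecOf 3 Lc (GcombSh Lc) (SpureCombOf (symTablesAn1S2 3 Lc cΛt) ((Lc : ℝ) ^ 4) (-((Lc : ℝ) ^ 8 / 2)) cΛ) (symTablesAn1S2 3 Lc cΛt).M cE₂ cB Tc
          (symTablesAn1S2 3 Lc cΛt).vh₂S (symTablesAn1S2 3 Lc cΛt).mixFF j)) κ κ' (Sum.inl κ₁) (Sum.inl κ₂)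
      + zmode Lc (unitS₂ sf sm (T2RecOf 3 Lc (GcombSh Lc) (SpureCombOf (symTablesAn1S2 3 Lc cΛt) ((Lc : ℝ) ^ 4) (-((Lc : ℝ) ^ 8 / 2)) cΛ) (symTablesAn1S2 3 Lc cΛt).M cE₂ cB Tc
          (symTablesAn1S2 3 Lc cΛt).vh₂S (symTablesAn1S2 3 Lc cΛt).mixFF j)) κ κ' (Sum.inl κ₂) (Sum.inl κ₁)
        = 0 :=
  zmode_unitS₂_T2RecOf_combChart_add_legSwap_eq_zero_of_law hLc (symTablesAn1S2 3 Lc cΛt) cΛ cE₂ cB Tc (hVfm_sym hLc) (hVmf_sym hLc) (hVmm_sym hLc)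
    (symVhSAt_hV0_ctr (d := 3) Lc) (hHr_sym' hLc) j γ h hhL hh R2 hR2c hR2p hlaw sf sm hodd

end Summit.QuantumFields.BalabanUV.Beta.GAN24.CombChartParityOddOfQuarticLaw

end
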